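import Mathlib
import Summits.ValiantsHypothesis.ValiantsHypothesis.Theorems.BarrierLeverPartitionMinorsHitByVPSimplexJoinFiveSlots

/-!
# Route BarrierLever — item `PartitionMinorsHitByVP` (19717): SIX slots at levels `(m₁, m₂, m₃, m₄, m₅, m₆)` (regime A)
Helper file (`--supports stmt-ValiantsHypothesis-19717`; cell valiant-natproofs, 𝒟-side door (c), line `hidden_states`, uniform-menu
lane; prover seat val-np-p3 gen 12). Definition-free; closes NO item. The 6-slot tensor of moment relations kills every row `U ⊆ A` with
`|U| ≤ Σ_f (m_f + 1) − 1` (`sum6_prod_eq_zero_levels`, wrapper over `sum5_prod_eq_zero_levels`); hence (`det_eq_zero_of_six_slots_levels`) a piece with 6 slots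
offering `≥ Σ_{i≤m_f} C(|A|,i)` options each makes the `u`-side matrix singular for EVERY table when all rows lie in `A` with size
`≤ Σ_f (m_f+1) − 1`. Case map of memo val-np-p3 g12 §2(f): every piece with ≥ 6 nontrivial slots dies by the level-0 pattern at `A = univ` (rows of size ≤ 5, available since r ≤ C(h,≤5)). Kernel (O2) for `j = 6`. Nothing on crux 14610 or VP ≠ VNP.
-/

set_option linter.dupNamespace false

namespace Summit.ValiantsHypothesis.ValiantsHypothesis.Theorems.BarrierLever.SimplexJoin

open Finset Matrix

/-- **Six moment relations kill every row of size `≤ Σ(m_f+1) − 1` inside `A`** (sum over the product grid). -/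
theorem sum6_prod_eq_zero_levels {h m₁ m₂ m₃ m₄ m₅ m₆ : ℕ} (A : Finset (Fin h)) {α β γ δ ε ζ : Type*} (L₁ : Finset α) (L₂ : Finset β) (L₃ : Finset γ) (L₄ : Finset δ) (L₅ : Finset ε) (L₆ : Finset ζ)
    (Λ : α → ℂ) (Μ : β → ℂ) (Ν : γ → ℂ) (Ξ : δ → ℂ) (Θ : ε → ℂ) (Ω : ζ → ℂ)
    (x : α → Fin h → ℂ) (y : β → Fin h → ℂ) (z : γ → Fin h → ℂ) (t : δ → Fin h → ℂ) (q : ε → Fin h → ℂ) (w : ζ → Fin h → ℂ) (c : Fin h → ℂ)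
    (hl : ∀ W, W ⊆ A → W.card ≤ m₁ → ∑ o ∈ L₁, Λ o * ∏ a ∈ W, x o a = 0)
    (hm : ∀ W, W ⊆ A → W.card ≤ m₂ → ∑ o ∈ L₂, Μ o * ∏ a ∈ W, y o a = 0)
    (hn : ∀ W, W ⊆ A → W.card ≤ m₃ → ∑ o ∈ L₃, Ν o * ∏ a ∈ W, z o a = 0)
    (hx : ∀ W, W ⊆ A → W.card ≤ m₄ → ∑ o ∈ L₄, Ξ o * ∏ a ∈ W, t o a = 0)
    (hq : ∀ W, W ⊆ A → W.card ≤ m₅ → ∑ o ∈ L₅, Θ o * ∏ a ∈ W, q o a = 0)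
    (hw : ∀ W, W ⊆ A → W.card ≤ m₆ → ∑ o ∈ L₆, Ω o * ∏ a ∈ W, w o a = 0)
    (U : Finset (Fin h)) (hUA : U ⊆ A) (hU : U.card ≤ m₁ + m₂ + m₃ + m₄ + m₅ + m₆ + 5) :
    ∑ oo ∈ L₁ ×ˢ (L₂ ×ˢ (L₃ ×ˢ (L₄ ×ˢ (L₅ ×ˢ L₆)))), Λ oo.1 * Μ oo.2.1 * Ν oo.2.2.1 * Ξ oo.2.2.2.1 * Θ oo.2.2.2.2.1 * Ω oo.2.2.2.2.2 *
      ∏ a ∈ U, (c a + x oo.1 a + y oo.2.1 a + z oo.2.2.1 a + t oo.2.2.2.1 a + q oo.2.2.2.2.1 a + w oo.2.2.2.2.2 a) = 0 := by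
  have hexp : ∀ o (pp : β × (γ × (δ × (ε × ζ)))), ∏ a ∈ U, (c a + x o a + y pp.1 a + z pp.2.1 a + t pp.2.2.1 a + q pp.2.2.2.1 a + w pp.2.2.2.2 a) =
      ∑ W ∈ U.powerset, (∏ a ∈ W, x o a) * ∏ a ∈ U \ W, (c a + y pp.1 a + z pp.2.1 a + t pp.2.2.1 a + q pp.2.2.2.1 a + w pp.2.2.2.2 a) := by
    intro o pp
    rw [← Finset.prod_add]
    exact Finset.prod_congr rfl fun a _ => by ring
  have hinner : ∀ W ∈ U.powerset, m₁ + 1 ≤ W.card →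
      ∑ pp ∈ L₂ ×ˢ (L₃ ×ˢ (L₄ ×ˢ (L₅ ×ˢ L₆))), Μ pp.1 * Ν pp.2.1 * Ξ pp.2.2.1 * Θ pp.2.2.2.1 * Ω pp.2.2.2.2 *
        ∏ a ∈ U \ W, (c a + y pp.1 a + z pp.2.1 a + t pp.2.2.1 a + q pp.2.2.2.1 a + w pp.2.2.2.2 a) = 0 := by
    intro W hW hWc
    have hWU : W ⊆ U := Finset.mem_powerset.mp hW
    have hrest : (U \ W).card ≤ m₂ + m₃ + m₄ + m₅ + m₆ + 4 := by
      have := Finset.card_sdiff_add_card_eq_card hWU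
      omega
    exact sum5_prod_eq_zero_levels A L₂ L₃ L₄ L₅ L₆ Μ Ν Ξ Θ Ω y z t q w c hm hn hx hq hw (U \ W) (Finset.sdiff_subset.trans hUA) hrest
  rw [Finset.sum_product]
  calc ∑ o ∈ L₁, ∑ pp ∈ L₂ ×ˢ (L₃ ×ˢ (L₄ ×ˢ (L₅ ×ˢ L₆))), Λ (o, pp).1 * Μ (o, pp).2.1 * Ν (o, pp).2.2.1 * Ξ (o, pp).2.2.2.1 * Θ (o, pp).2.2.2.2.1 * Ω (o, pp).2.2.2.2.2 *
          ∏ a ∈ U, (c a + x (o, pp).1 a + y (o, pp).2.1 a + z (o, pp).2.2.1 a + t (o, pp).2.2.2.1 a + q (o, pp).2.2.2.2.1 a + w (o, pp).2.2.2.2.2 a)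
      = ∑ o ∈ L₁, ∑ pp ∈ L₂ ×ˢ (L₃ ×ˢ (L₄ ×ˢ (L₅ ×ˢ L₆))), ∑ W ∈ U.powerset,
          (Λ o * ∏ a ∈ W, x o a) * (Μ pp.1 * Ν pp.2.1 * Ξ pp.2.2.1 * Θ pp.2.2.2.1 * Ω pp.2.2.2.2 *
            ∏ a ∈ U \ W, (c a + y pp.1 a + z pp.2.1 a + t pp.2.2.1 a + q pp.2.2.2.1 a + w pp.2.2.2.2 a)) := by
        refine Finset.sum_congr rfl fun o _ => Finset.sum_congr rfl fun pp _ => ?_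
        simp only []
        rw [hexp, Finset.mul_sum]
        exact Finset.sum_congr rfl fun W _ => by ring
    _ = ∑ o ∈ L₁, ∑ W ∈ U.powerset, (Λ o * ∏ a ∈ W, x o a) *
          ∑ pp ∈ L₂ ×ˢ (L₃ ×ˢ (L₄ ×ˢ (L₅ ×ˢ L₆))), (Μ pp.1 * Ν pp.2.1 * Ξ pp.2.2.1 * Θ pp.2.2.2.1 * Ω pp.2.2.2.2 *
            ∏ a ∈ U \ W, (c a + y pp.1 a + z pp.2.1 a + t pp.2.2.1 a + q pp.2.2.2.1 a + w pp.2.2.2.2 a)) := by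
        refine Finset.sum_congr rfl fun o _ => ?_
        rw [Finset.sum_comm]
        exact Finset.sum_congr rfl fun W _ => by rw [Finset.mul_sum]
    _ = ∑ W ∈ U.powerset, (∑ o ∈ L₁, Λ o * ∏ a ∈ W, x o a) *
          ∑ pp ∈ L₂ ×ˢ (L₃ ×ˢ (L₄ ×ˢ (L₅ ×ˢ L₆))), (Μ pp.1 * Ν pp.2.1 * Ξ pp.2.2.1 * Θ pp.2.2.2.1 * Ω pp.2.2.2.2 *
            ∏ a ∈ U \ W, (c a + y pp.1 a + z pp.2.1 a + t pp.2.2.1 a + q pp.2.2.2.1 a + w pp.2.2.2.2 a)) := by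
        rw [Finset.sum_comm]
        exact Finset.sum_congr rfl fun W _ => by rw [Finset.sum_mul]
    _ = 0 := by
        refine Finset.sum_eq_zero fun W hW => ?_
        have hWU : W ⊆ U := Finset.mem_powerset.mp hW
        by_cases hWc : W.card ≤ m₁
        · rw [hl W (hWU.trans hUA) hWc, zero_mul]
        · rw [hinner W hW (by omega), mul_zero]

/-- **SIX SLOTS AT LEVELS `(m₁, m₂, m₃, m₄, m₅, m₆)`, regime A.** -/
theorem det_eq_zero_of_six_slots_levels (h m₁ m₂ m₃ m₄ m₅ m₆ M D N r : ℕ) (A : Finset (Fin h)) (u : Fin r → Finset (Fin h))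
    (huA : ∀ i, u i ⊆ A) (hum : ∀ i, (u i).card ≤ m₁ + m₂ + m₃ + m₄ + m₅ + m₆ + 5)
    (S : Fin M → Fin D → Finset (Fin N))
    (e : Fin r → Fin M × (Fin D → Option (Fin N))) (he : Function.Injective e)
    (hlive : ∀ c : Fin M × (Fin D → Option (Fin N)),
      c ∈ Set.range e ↔ ∀ (f : Fin D) (j : Fin N), c.2 f = some j → j ∈ S c.1 f)
    (p : Fin M) (f₁ f₂ f₃ f₄ f₅ f₆ : Fin D) (h12 : f₁ ≠ f₂) (h13 : f₁ ≠ f₃) (h14 : f₁ ≠ f₄) (h15 : f₁ ≠ f₅) (h16 : f₁ ≠ f₆) (h23 : f₂ ≠ f₃) (h24 : f₂ ≠ f₄) (h25 : f₂ ≠ f₅) (h26 : f₂ ≠ f₆) (h34 : f₃ ≠ f₄) (h35 : f₃ ≠ f₅) (h36 : f₃ ≠ f₆) (h45 : f₄ ≠ f₅) (h46 : f₄ ≠ f₆) (h56 : f₅ ≠ f₆)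
    (hS₁ : ∑ i ∈ Finset.range (m₁ + 1), A.card.choose i ≤ (S p f₁).card)
    (hS₂ : ∑ i ∈ Finset.range (m₂ + 1), A.card.choose i ≤ (S p f₂).card)
    (hS₃ : ∑ i ∈ Finset.range (m₃ + 1), A.card.choose i ≤ (S p f₃).card)
    (hS₄ : ∑ i ∈ Finset.range (m₄ + 1), A.card.choose i ≤ (S p f₄).card)
    (hS₅ : ∑ i ∈ Finset.range (m₅ + 1), A.card.choose i ≤ (S p f₅).card)
    (hS₆ : ∑ i ∈ Finset.range (m₆ + 1), A.card.choose i ≤ (S p f₆).card)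
    (T : Fin M → Option (Fin D × Fin N) → Fin h → ℂ) :
    (Matrix.of fun i k : Fin r => ∏ a ∈ u i,
      (T (e k).1 none a + ∑ f : Fin D, ((e k).2 f).elim 0 fun j => T (e k).1 (some (f, j)) a)).det = 0 := by
  classical
  set L₁ : Finset (Option (Fin N)) := Finset.insertNone (S p f₁) with hL₁
  set L₂ : Finset (Option (Fin N)) := Finset.insertNone (S p f₂) with hL₂
  set L₃ : Finset (Option (Fin N)) := Finset.insertNone (S p f₃) with hL₃
  set L₄ : Finset (Option (Fin N)) := Finset.insertNone (S p f₄) with hL₄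
  set L₅ : Finset (Option (Fin N)) := Finset.insertNone (S p f₅) with hL₅
  set L₆ : Finset (Option (Fin N)) := Finset.insertNone (S p f₆) with hL₆
  let x : Option (Fin N) → Fin h → ℂ := fun o a => o.elim 0 fun j => T p (some (f₁, j)) a
  let y : Option (Fin N) → Fin h → ℂ := fun o a => o.elim 0 fun j => T p (some (f₂, j)) a
  let z : Option (Fin N) → Fin h → ℂ := fun o a => o.elim 0 fun j => T p (some (f₃, j)) a
  let t : Option (Fin N) → Fin h → ℂ := fun o a => o.elim 0 fun j => T p (some (f₄, j)) a
  let q : Option (Fin N) → Fin h → ℂ := fun o a => o.elim 0 fun j => T p (some (f₅, j)) a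
  let w : Option (Fin N) → Fin h → ℂ := fun o a => o.elim 0 fun j => T p (some (f₆, j)) a
  have hc₁ : (A.powerset.filter (fun W => W.card ≤ m₁)).card < L₁.card := by
    rw [card_filter_powerset_card_le A m₁, hL₁, Finset.card_insertNone]; omega
  have hc₂ : (A.powerset.filter (fun W => W.card ≤ m₂)).card < L₂.card := by
    rw [card_filter_powerset_card_le A m₂, hL₂, Finset.card_insertNone]; omega
  have hc₃ : (A.powerset.filter (fun W => W.card ≤ m₃)).card < L₃.card := by
    rw [card_filter_powerset_card_le A m₃, hL₃, Finset.card_insertNone]; omega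
  have hc₄ : (A.powerset.filter (fun W => W.card ≤ m₄)).card < L₄.card := by
    rw [card_filter_powerset_card_le A m₄, hL₄, Finset.card_insertNone]; omega
  have hc₅ : (A.powerset.filter (fun W => W.card ≤ m₅)).card < L₅.card := by
    rw [card_filter_powerset_card_le A m₅, hL₅, Finset.card_insertNone]; omega
  have hc₆ : (A.powerset.filter (fun W => W.card ≤ m₆)).card < L₆.card := by
    rw [card_filter_powerset_card_le A m₆, hL₆, Finset.card_insertNone]; omega
  obtain ⟨Λ, hl, o₁, ho₁, hΛ⟩ := momentRelation_of_card_lt h m₁ A L₁ x hc₁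
  obtain ⟨Μ, hm, o₂, ho₂, hΜ⟩ := momentRelation_of_card_lt h m₂ A L₂ y hc₂
  obtain ⟨Ν, hn, o₃, ho₃, hΝ⟩ := momentRelation_of_card_lt h m₃ A L₃ z hc₃
  obtain ⟨Ξ, hx, o₄, ho₄, hΞ⟩ := momentRelation_of_card_lt h m₄ A L₄ t hc₄
  obtain ⟨Θ, hq, o₅, ho₅, hΘ⟩ := momentRelation_of_card_lt h m₅ A L₅ q hc₅
  obtain ⟨Ω, hw, o₆, ho₆, hΩ⟩ := momentRelation_of_card_lt h m₆ A L₆ w hc₆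
  let pat : Option (Fin N) → Option (Fin N) → Option (Fin N) → Option (Fin N) → Option (Fin N) → Option (Fin N) → (Fin D → Option (Fin N)) :=
    fun o o' o'' o''' o'''' o''''' f => if f = f₁ then o else if f = f₂ then o' else if f = f₃ then o'' else if f = f₄ then o''' else if f = f₅ then o'''' else if f = f₆ then o''''' else none
  have hpat₁ : ∀ o o' o'' o''' o'''' o''''', pat o o' o'' o''' o'''' o''''' f₁ = o := fun _ _ _ _ _ _ => by simp [pat]
  have hpat₂ : ∀ o o' o'' o''' o'''' o''''', pat o o' o'' o''' o'''' o''''' f₂ = o' := fun _ _ _ _ _ _ => by simp [pat, h12.symm]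
  have hpat₃ : ∀ o o' o'' o''' o'''' o''''', pat o o' o'' o''' o'''' o''''' f₃ = o'' := fun _ _ _ _ _ _ => by simp [pat, h13.symm, h23.symm]
  have hpat₄ : ∀ o o' o'' o''' o'''' o''''', pat o o' o'' o''' o'''' o''''' f₄ = o''' := fun _ _ _ _ _ _ => by simp [pat, h14.symm, h24.symm, h34.symm]
  have hpat₅ : ∀ o o' o'' o''' o'''' o''''', pat o o' o'' o''' o'''' o''''' f₅ = o'''' := fun _ _ _ _ _ _ => by simp [pat, h15.symm, h25.symm, h35.symm, h45.symm]
  have hpat₆ : ∀ o o' o'' o''' o'''' o''''', pat o o' o'' o''' o'''' o''''' f₆ = o''''' := fun _ _ _ _ _ _ => by simp [pat, h16.symm, h26.symm, h36.symm, h46.symm, h56.symm]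
  have hpat₀ : ∀ o o' o'' o''' o'''' o''''' f, f ≠ f₁ → f ≠ f₂ → f ≠ f₃ → f ≠ f₄ → f ≠ f₅ → f ≠ f₆ → pat o o' o'' o''' o'''' o''''' f = none :=
    fun _ _ _ _ _ _ f h1 h2 h3 h4 h5 h6 => by simp [pat, h1, h2, h3, h4, h5, h6]
  have hlivepat : ∀ o ∈ L₁, ∀ o' ∈ L₂, ∀ o'' ∈ L₃, ∀ o''' ∈ L₄, ∀ o'''' ∈ L₅, ∀ o''''' ∈ L₆, (p, pat o o' o'' o''' o'''' o''''') ∈ Set.range e := by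
    intro o ho o' hop o'' hopp o''' hoppp o'''' hopppp o''''' hoppppp
    rw [hlive]
    intro f j hfj
    change pat o o' o'' o''' o'''' o''''' f = some j at hfj
    change j ∈ S p f
    by_cases h1 : f = f₁
    · rw [h1, hpat₁] at hfj; rw [h1]; exact Finset.mem_insertNone.mp ho j (by rw [hfj]; rfl)
    · by_cases h2 : f = f₂
      · rw [h2, hpat₂] at hfj; rw [h2]; exact Finset.mem_insertNone.mp hop j (by rw [hfj]; rfl)
      · by_cases h3 : f = f₃
        · rw [h3, hpat₃] at hfj; rw [h3]; exact Finset.mem_insertNone.mp hopp j (by rw [hfj]; rfl)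
        · by_cases h4 : f = f₄
          · rw [h4, hpat₄] at hfj; rw [h4]; exact Finset.mem_insertNone.mp hoppp j (by rw [hfj]; rfl)
          · by_cases h5 : f = f₅
            · rw [h5, hpat₅] at hfj; rw [h5]; exact Finset.mem_insertNone.mp hopppp j (by rw [hfj]; rfl)
            · by_cases h6 : f = f₆
              · rw [h6, hpat₆] at hfj; rw [h6]; exact Finset.mem_insertNone.mp hoppppp j (by rw [hfj]; rfl)
              · rw [hpat₀ o o' o'' o''' o'''' o''''' f h1 h2 h3 h4 h5 h6] at hfj; exact absurd hfj (by simp)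

  let InGrid : Fin r → Prop := fun k => (e k).1 = p ∧ ∀ f, f ≠ f₁ → f ≠ f₂ → f ≠ f₃ → f ≠ f₄ → f ≠ f₅ → f ≠ f₆ → (e k).2 f = none
  have hgrid : ∀ k, InGrid k → ∀ (f : Fin D) (L : Finset (Option (Fin N))), L = Finset.insertNone (S p f) → (e k).2 f ∈ L := by
    intro k hk f L hL
    rw [hL, Finset.mem_insertNone]
    intro j hj
    have := ((hlive (e k)).mp ⟨k, rfl⟩) f j hj
    rw [hk.1] at this; exact this
  have hgridpat : ∀ k, InGrid k → e k = (p, pat ((e k).2 f₁) ((e k).2 f₂) ((e k).2 f₃) ((e k).2 f₄) ((e k).2 f₅) ((e k).2 f₆)) := by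
    intro k hk
    refine Prod.ext hk.1 (funext fun f => ?_)
    change (e k).2 f = pat ((e k).2 f₁) ((e k).2 f₂) ((e k).2 f₃) ((e k).2 f₄) ((e k).2 f₅) ((e k).2 f₆) f
    by_cases h1 : f = f₁
    · rw [h1, hpat₁]
    · by_cases h2 : f = f₂
      · rw [h2, hpat₂]
      · by_cases h3 : f = f₃
        · rw [h3, hpat₃]
        · by_cases h4 : f = f₄
          · rw [h4, hpat₄]
          · by_cases h5 : f = f₅
            · rw [h5, hpat₅]
            · by_cases h6 : f = f₆
              · rw [h6, hpat₆]
              · rw [hpat₀ _ _ _ _ _ _ f h1 h2 h3 h4 h5 h6]; exact hk.2 f h1 h2 h3 h4 h5 h6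

  set G := L₁ ×ˢ (L₂ ×ˢ (L₃ ×ˢ (L₄ ×ˢ (L₅ ×ˢ L₆)))) with hG
  have hmemG : ∀ oo : Option (Fin N) × (Option (Fin N) × (Option (Fin N) × (Option (Fin N) × (Option (Fin N) × Option (Fin N))))),
      oo ∈ G ↔ oo.1 ∈ L₁ ∧ oo.2.1 ∈ L₂ ∧ oo.2.2.1 ∈ L₃ ∧ oo.2.2.2.1 ∈ L₄ ∧ oo.2.2.2.2.1 ∈ L₅ ∧ oo.2.2.2.2.2 ∈ L₆ := by
    intro oo; simp only [hG, Finset.mem_product]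
  have hkOf : ∀ oo : Option (Fin N) × (Option (Fin N) × (Option (Fin N) × (Option (Fin N) × (Option (Fin N) × Option (Fin N))))), oo ∈ G →
      ∃ k, e k = (p, pat oo.1 oo.2.1 oo.2.2.1 oo.2.2.2.1 oo.2.2.2.2.1 oo.2.2.2.2.2) := by
    intro oo hoo
    obtain ⟨ho1, ho2, ho3, ho4, ho5, ho6⟩ := (hmemG oo).mp hoo
    exact hlivepat oo.1 ho1 oo.2.1 ho2 oo.2.2.1 ho3 oo.2.2.2.1 ho4 oo.2.2.2.2.1 ho5 oo.2.2.2.2.2 ho6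
  have hG0 : (o₁, (o₂, (o₃, (o₄, (o₅, o₆))))) ∈ G := (hmemG _).mpr ⟨ho₁, ho₂, ho₃, ho₄, ho₅, ho₆⟩
  let kOf : Option (Fin N) × (Option (Fin N) × (Option (Fin N) × (Option (Fin N) × (Option (Fin N) × Option (Fin N))))) → Fin r := fun oo =>
    if hoo : oo ∈ G then (hkOf oo hoo).choose else ⟨0, Fin.pos (hkOf _ hG0).choose⟩
  have hkOf_spec : ∀ oo ∈ G, e (kOf oo) = (p, pat oo.1 oo.2.1 oo.2.2.1 oo.2.2.2.1 oo.2.2.2.2.1 oo.2.2.2.2.2) := by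
    intro oo hoo; simp only [kOf, dif_pos hoo]; exact (hkOf oo hoo).choose_spec
  have hkOf_grid : ∀ oo ∈ G, InGrid (kOf oo) := by
    intro oo hoo; refine ⟨by rw [hkOf_spec oo hoo], fun f h1 h2 h3 h4 h5 h6 => ?_⟩
    rw [hkOf_spec oo hoo]; exact hpat₀ _ _ _ _ _ _ f h1 h2 h3 h4 h5 h6
  let v : Fin r → ℂ := fun k =>
    if InGrid k then Λ ((e k).2 f₁) * Μ ((e k).2 f₂) * Ν ((e k).2 f₃) * Ξ ((e k).2 f₄) * Θ ((e k).2 f₅) * Ω ((e k).2 f₆) else 0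
  have hv : v ≠ 0 := by
    intro hv
    have h0 := congrFun hv (kOf (o₁, (o₂, (o₃, (o₄, (o₅, o₆))))))
    have h1 : v (kOf (o₁, (o₂, (o₃, (o₄, (o₅, o₆)))))) = Λ ((e (kOf (o₁, (o₂, (o₃, (o₄, (o₅, o₆))))))).2 f₁) * Μ ((e (kOf (o₁, (o₂, (o₃, (o₄, (o₅, o₆))))))).2 f₂) * Ν ((e (kOf (o₁, (o₂, (o₃, (o₄, (o₅, o₆))))))).2 f₃) * Ξ ((e (kOf (o₁, (o₂, (o₃, (o₄, (o₅, o₆))))))).2 f₄) * Θ ((e (kOf (o₁, (o₂, (o₃, (o₄, (o₅, o₆))))))).2 f₅) * Ω ((e (kOf (o₁, (o₂, (o₃, (o₄, (o₅, o₆))))))).2 f₆) := if_pos (hkOf_grid _ hG0)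
    rw [h1, hkOf_spec _ hG0, Pi.zero_apply] at h0
    change Λ (pat o₁ o₂ o₃ o₄ o₅ o₆ f₁) * Μ (pat o₁ o₂ o₃ o₄ o₅ o₆ f₂) * Ν (pat o₁ o₂ o₃ o₄ o₅ o₆ f₃) * Ξ (pat o₁ o₂ o₃ o₄ o₅ o₆ f₄) * Θ (pat o₁ o₂ o₃ o₄ o₅ o₆ f₅) * Ω (pat o₁ o₂ o₃ o₄ o₅ o₆ f₆) = 0 at h0
    rw [hpat₁, hpat₂, hpat₃, hpat₄, hpat₅, hpat₆] at h0
    exact absurd h0 (by simp [hΛ, hΜ, hΝ, hΞ, hΘ, hΩ])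
  have hpoint : ∀ k, InGrid k → ∀ a, T (e k).1 none a + ∑ f : Fin D, ((e k).2 f).elim 0 (fun j => T (e k).1 (some (f, j)) a) =
      T p none a + x ((e k).2 f₁) a + y ((e k).2 f₂) a + z ((e k).2 f₃) a + t ((e k).2 f₄) a + q ((e k).2 f₅) a + w ((e k).2 f₆) a := by
    intro k hk a
    rw [hk.1]
    have hsub : ({f₁, f₂, f₃, f₄, f₅, f₆} : Finset (Fin D)) ⊆ Finset.univ := Finset.subset_univ _
    rw [← Finset.sum_subset hsub]
    · rw [Finset.sum_insert (by simp [h12, h13, h14, h15, h16]), Finset.sum_insert (by simp [h23, h24, h25, h26]), Finset.sum_insert (by simp [h34, h35, h36]), Finset.sum_insert (by simp [h45, h46]), Finset.sum_insert (by simp [h56]), Finset.sum_singleton]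
      simp only [x, y, z, t, q, w, add_assoc]
    · intro f _ hf
      simp only [Finset.mem_insert, Finset.mem_singleton, not_or] at hf
      rw [hk.2 f hf.1 hf.2.1 hf.2.2.1 hf.2.2.2.1 hf.2.2.2.2.1 hf.2.2.2.2.2]; rfl
  apply (Matrix.exists_mulVec_eq_zero_iff).mp
  refine ⟨v, hv, funext fun i => ?_⟩
  simp only [Matrix.mulVec, dotProduct, Matrix.of_apply, Pi.zero_apply]
  calc ∑ k, (∏ a ∈ u i, (T (e k).1 none a + ∑ f : Fin D, ((e k).2 f).elim 0 fun j => T (e k).1 (some (f, j)) a)) * v k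
      = ∑ k ∈ Finset.univ.filter InGrid, Λ ((e k).2 f₁) * Μ ((e k).2 f₂) * Ν ((e k).2 f₃) * Ξ ((e k).2 f₄) * Θ ((e k).2 f₅) * Ω ((e k).2 f₆) *
          ∏ a ∈ u i, (T p none a + x ((e k).2 f₁) a + y ((e k).2 f₂) a + z ((e k).2 f₃) a + t ((e k).2 f₄) a + q ((e k).2 f₅) a + w ((e k).2 f₆) a) := by
        rw [Finset.sum_filter]
        refine Finset.sum_congr rfl fun k _ => ?_
        by_cases hk : InGrid k
        · have hv' : v k = Λ ((e k).2 f₁) * Μ ((e k).2 f₂) * Ν ((e k).2 f₃) * Ξ ((e k).2 f₄) * Θ ((e k).2 f₅) * Ω ((e k).2 f₆) := if_pos hk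
          rw [if_pos hk, hv', Finset.prod_congr rfl fun a _ => hpoint k hk a]
          ring
        · have hv' : v k = 0 := if_neg hk
          rw [if_neg hk, hv', mul_zero]
    _ = ∑ oo ∈ G, Λ oo.1 * Μ oo.2.1 * Ν oo.2.2.1 * Ξ oo.2.2.2.1 * Θ oo.2.2.2.2.1 * Ω oo.2.2.2.2.2 *
          ∏ a ∈ u i, (T p none a + x oo.1 a + y oo.2.1 a + z oo.2.2.1 a + t oo.2.2.2.1 a + q oo.2.2.2.2.1 a + w oo.2.2.2.2.2 a) := by
        refine Finset.sum_nbij' (fun k => ((e k).2 f₁, ((e k).2 f₂, ((e k).2 f₃, ((e k).2 f₄, ((e k).2 f₅, (e k).2 f₆)))))) kOf ?_ ?_ ?_ ?_ ?_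
        · intro k hk
          have hk' := (Finset.mem_filter.mp hk).2
          exact (hmemG _).mpr ⟨hgrid k hk' f₁ L₁ hL₁, hgrid k hk' f₂ L₂ hL₂, hgrid k hk' f₃ L₃ hL₃, hgrid k hk' f₄ L₄ hL₄, hgrid k hk' f₅ L₅ hL₅, hgrid k hk' f₆ L₆ hL₆⟩
        · intro oo hoo
          exact Finset.mem_filter.mpr ⟨Finset.mem_univ _, hkOf_grid oo hoo⟩
        · intro k hk
          have hk' := (Finset.mem_filter.mp hk).2
          have hoo : ((e k).2 f₁, ((e k).2 f₂, ((e k).2 f₃, ((e k).2 f₄, ((e k).2 f₅, (e k).2 f₆))))) ∈ G :=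
            (hmemG _).mpr ⟨hgrid k hk' f₁ L₁ hL₁, hgrid k hk' f₂ L₂ hL₂, hgrid k hk' f₃ L₃ hL₃, hgrid k hk' f₄ L₄ hL₄, hgrid k hk' f₅ L₅ hL₅, hgrid k hk' f₆ L₆ hL₆⟩
          apply he
          rw [hkOf_spec _ hoo, ← hgridpat k hk']
        · intro oo hoo
          refine Prod.ext ?_ (Prod.ext ?_ (Prod.ext ?_ (Prod.ext ?_ (Prod.ext ?_ ?_))))
          · show (e (kOf oo)).2 f₁ = oo.1
            rw [hkOf_spec oo hoo]; exact hpat₁ _ _ _ _ _ _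
          · show (e (kOf oo)).2 f₂ = oo.2.1
            rw [hkOf_spec oo hoo]; exact hpat₂ _ _ _ _ _ _
          · show (e (kOf oo)).2 f₃ = oo.2.2.1
            rw [hkOf_spec oo hoo]; exact hpat₃ _ _ _ _ _ _
          · show (e (kOf oo)).2 f₄ = oo.2.2.2.1
            rw [hkOf_spec oo hoo]; exact hpat₄ _ _ _ _ _ _
          · show (e (kOf oo)).2 f₅ = oo.2.2.2.2.1
            rw [hkOf_spec oo hoo]; exact hpat₅ _ _ _ _ _ _
          · show (e (kOf oo)).2 f₆ = oo.2.2.2.2.2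
            rw [hkOf_spec oo hoo]; exact hpat₆ _ _ _ _ _ _
        · intro k _; rfl
    _ = 0 := sum6_prod_eq_zero_levels A L₁ L₂ L₃ L₄ L₅ L₆ Λ Μ Ν Ξ Θ Ω x y z t q w (fun a => T p none a) hl hm hn hx hq hw (u i) (huA i) (hum i)

end Summit.ValiantsHypothesis.ValiantsHypothesis.Theorems.BarrierLever.SimplexJoin
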